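import Summits.BirchSwinnertonDyer.BirchSwinnertonDyer.Theorems.SignedLowerHalvesKobayashiLowerHalfLargeImageParityStratumOrder
import Summits.BirchSwinnertonDyer.BirchSwinnertonDyer.Theorems.SignedLowerHalvesKobayashiLowerHalfLargeImageParityStratumMainConjecture
import Literature.NumberTheory.EllipticCurves.Sprung2017.SharpFlatFunctionalEquationApZeroProofs
import HarnessLib

/-!
# Route `SignedLowerHalves`, crux 3 `KobayashiLowerHalfLargeImage` (item stmt-BirchSwinnertonDyer-19001):
# the PARITY STRATUM, part 4 — the functional-equation hypothesis DISCHARGED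
# (cell `bsd-ssimc`, seat `bsd-line-slh-p1` LEAD gen 12; helper file `--supports 19001`)

Parts 1–3 (`…ParityStratum.lean`, `…ParityStratumMainConjecture.lean`, `…ParityStratumCrux.lean`,
`…ParityStratumOrder.lean`) carry Sprung's functional equation of the signed pair at `a_p = 0` as the
named-fact binder `hFE : Sprung2017.cor414_sharpFlat_functionalEquation_apZero`. That fact is now a
THEOREM of the tree (`Sprung2017.cor414_sharpFlat_functionalEquation_apZero_holds`,
`Literature/NumberTheory/EllipticCurves/Sprung2017/SharpFlatFunctionalEquationApZeroProofs.lean`: the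
finite-level Mazur–Tate functional equation transported to Sprung's combination `u_n L♯ + v_n L♭`, the
`ι`-weights `⌊pⁿ/(p+1)⌋` of `u_n`, `v_n` interpolated by `a = −p/(p+1)`, `b = −1/(p+1)`, and uniqueness
of the pair). This file records the headline statements with `hFE` FED, so that the remaining
hypotheses are exactly: Kobayashi 2003 Thm. 1.2 (`h12`) [+ Thm. 4.1 `h41`, Wuthrich Lemma 20 `hL20`
where the Kato side is used], the period-unit facts (`h5`, `h3`), the `p`-parity theorem (`hpar`), and
the per-pair certificate. HONEST FRAMING: the crux is OPEN; calibration/support only (D34-4 (3)); BSD is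
not proved by any of this.

* `rootNumber_eq_neg_one_pow_order'` — `w(E) = (−1)^{ord_T L_p^ε}` at the conductor level, NO named fact.
* `kobayashiLowerDivisibility_of_lam_le_one'` — the Eisenstein half on `{μ(L_p^ε) = 0, λ(L_p^ε) ≤ 1}`,
  granted `h12`, `h5`, `h3`, `hpar` only.
* `kobayashiMainConjecture_of_lam_eq_one_of_p_parity'` — the rank-free signed main conjecture at a
  `(0, 1)`-certified pair with surjective `ρ̄`, granted `h12`, `h41`, `h5`, `h3`, `hL20`, `hpar`.
* (the crux-level corollary `kobayashiLowerHalfLargeImage_iff_offStratum'` — crux 3 BY NAME ⟺ its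
  off-stratum part modulo `h12`, `h5`, `h3`, `∀ p_parity` — is appended to `…ParityStratumCrux.lean`,
  the file that imports the route file.)

References: [Sprung2017] Cor. 4.14; [Kobayashi2003] Thm. 1.2, 4.1, Conjecture (p. 2);
[DokchitserDokchitserAnnals2010] Thm. 1.4; [GreenbergLNM1716] §5 p. 181.
-/

set_option autoImplicit false
set_option linter.dupNamespace false

noncomputable section

open scoped Classical MatrixGroups ModularForm

open CongruenceSubgroup PowerSeries WeierstrassCurve Literature.NumberTheory.EllipticCurves
  Literature.NumberTheory.EllipticCurves.ModularForms
  Literature.NumberTheory.EllipticCurves.Rank1Residual Literature.NumberTheory.EllipticCurves.Sprung2017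
  Literature.NumberTheory.EllipticCurves.Kobayashi2003 ZpExtension
  Literature.NumberTheory.EllipticCurves.Rank1Residual.Typed
  Summit.BirchSwinnertonDyer.Rank1Residual.X1.MuLambda
  Summit.BirchSwinnertonDyer.Rank1Residual.Supersingular

namespace Summit.BirchSwinnertonDyer.BirchSwinnertonDyer.Theorems.LargeImageParityStratum

variable (W : WeierstrassCurve ℚ) [W.IsElliptic] [W.IsGloballyMinimal] (p : ℕ) [Fact p.Prime]

/-- **`w(E) = (−1)^{ord_T L_p^ε}` for either sign, with NO named-fact hypothesis**: odd good `p`,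
`a_p = 0`, the newform `f` of level `N_E`, any Pollack pair `(L⁺, L⁻)` (Sprung's functional equation is
now the tree theorem `cor414_sharpFlat_functionalEquation_apZero_holds`).
[cite: Sprung2017, Cor. 4.14 (a_p = 0 display)] [cite: GreenbergLNM1716, §5 (p. 181)] -/
theorem rootNumber_eq_neg_one_pow_order'
    (hp : p ≠ 2) (hgood : W.HasGoodReductionAtPrime p) (hap : W.frobeniusTrace p = 0)
    [NeZero (W.conductorNorm ℤ)] {f : CuspForm (Gamma0 (W.conductorNorm ℤ)) 2} (hf : IsNewformOf W f)
    {Lplus Lminus : IwasawaAlgebra p} (hPP : IsPollackPair f p Lplus Lminus) (ε : ℤˣ) :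
    W.rootNumber = (-1) ^ (kobayashiL ε Lplus Lminus).order.toNat :=
  rootNumber_eq_neg_one_pow_order W p cor414_sharpFlat_functionalEquation_apZero_holds hp hgood hap hf
    hPP ε

/-- **`ord_T L_p^ε ≡ corank_{ℤ_p} Sel_{p^∞}(E/ℚ) (mod 2)`**, granted ONLY the `p`-parity theorem
(`hpar : p_parity W p`). [cite: DokchitserDokchitserAnnals2010, Thm. 1.4] [cite: Sprung2017, Cor. 4.14 (a_p = 0 display)] -/
theorem even_order_iff_even_selmerCorank' (hpar : p_parity W p)
    (hp : p ≠ 2) (hgood : W.HasGoodReductionAtPrime p) (hap : W.frobeniusTrace p = 0)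
    [NeZero (W.conductorNorm ℤ)] {f : CuspForm (Gamma0 (W.conductorNorm ℤ)) 2} (hf : IsNewformOf W f)
    {Lplus Lminus : IwasawaAlgebra p} (hPP : IsPollackPair f p Lplus Lminus) (ε : ℤˣ) :
    Even (kobayashiL ε Lplus Lminus).order.toNat ↔ Even (W.selmerCorank p) :=
  even_order_iff_even_selmerCorank W p hpar cor414_sharpFlat_functionalEquation_apZero_holds hp hgood
    hap hf hPP ε

/-- **The Eisenstein half `KobayashiLowerDivisibility W p ε` on the parity stratum
`{μ(L_p^ε) = 0, λ(L_p^ε) ≤ 1}`, granted Kobayashi Thm. 1.2 (`h12`), the period-unit facts (`h5`, `h3`)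
and the `p`-parity theorem (`hpar`) ONLY** — Sprung's functional equation fed by its tree proof. NO
rank, image or Kato hypothesis. [cite: Kobayashi2003, Thm. 1.2 (p. 2) and Conjecture (p. 2)]
[cite: DokchitserDokchitserAnnals2010, Thm. 1.4] [cite: GreenbergVatsal2000, p. 4 and §3 Remark 3.4] -/
theorem kobayashiLowerDivisibility_of_lam_le_one'
    (h12 : Kobayashi2003.thm12_signedSelmerDual_finite_torsion)
    (h5 : realPeriodRat_eq_unit_mul_plusPeriod) (h3 : realPeriodRat_eq_unit_mul_plusPeriod_three)
    (hpar : p_parity W p)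
    (hp : p ≠ 2) (hgood : W.HasGoodReductionAtPrime p) (hap : W.frobeniusTrace p = 0) (ε : ℤˣ)
    [NeZero (W.conductorNorm ℤ)] {f₀ : CuspForm (Gamma0 (W.conductorNorm ℤ)) 2} (hf₀ : IsNewformOf W f₀)
    (hcert₀ : ∀ L : IwasawaAlgebra p, IsSignedPAdicLFunction f₀ p ε L → mu L = 0 ∧ lam L ≤ 1) :
    KobayashiLowerDivisibility W p ε :=
  kobayashiLowerDivisibility_of_lam_le_one W p h12 h5 h3 hpar
    cor414_sharpFlat_functionalEquation_apZero_holds hp hgood hap ε hf₀ hcert₀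

/-- **The rank-free signed main conjecture at a `(0, 1)`-certified pair with surjective `ρ̄_{E,p}`**,
granted `h12`, `h41`, `h5`, `h3`, `hL20`, `hpar` — Sprung's functional equation fed by its tree proof.
[cite: Kobayashi2003, Thm. 1.2 (p. 2), Thm. 4.1 (p. 8) and Conjecture (p. 2)] [cite: DokchitserDokchitserAnnals2010, Thm. 1.4]
[cite: Wuthrich2014, Lemma 20 (p. 399)] -/
theorem kobayashiMainConjecture_of_lam_eq_one_of_p_parity'
    (h12 : Kobayashi2003.thm12_signedSelmerDual_finite_torsion)
    (h41 : Kobayashi2003.thm41_signedCharIdeal_divisibility)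
    (h5 : realPeriodRat_eq_unit_mul_plusPeriod) (h3 : realPeriodRat_eq_unit_mul_plusPeriod_three)
    (hL20 : Wuthrich2014.lemma20_surjective_threeAdic_of_semistable) (hpar : p_parity W p)
    (hp : p ≠ 2) (hgood : W.HasGoodReductionAtPrime p) (hap : W.frobeniusTrace p = 0)
    (hs : Surj W p) (ε : ℤˣ)
    [NeZero (W.conductorNorm ℤ)] {f₀ : CuspForm (Gamma0 (W.conductorNorm ℤ)) 2} (hf₀ : IsNewformOf W f₀)
    (hcert₀ : ∀ L : IwasawaAlgebra p, IsSignedPAdicLFunction f₀ p ε L → mu L = 0 ∧ lam L = 1) :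
    KobayashiMainConjecture W p ε :=
  kobayashiMainConjecture_of_lam_eq_one_of_p_parity W p h12 h41 h5 h3 hL20 hpar
    cor414_sharpFlat_functionalEquation_apZero_holds hp hgood hap hs ε hf₀ hcert₀

/-- **Kobayashi's main conjecture for `(E, p, −1)` from ONE odd-level Mazur–Tate element with
`λ(Θ) = deg ω_n^+ + 1`**, surjective `ρ̄_{E,p}`, granted `h12`, `h41`, `h5`, `h3`, `hL20`, `hpar` — no
rank hypothesis, no functional-equation hypothesis. [cite: Kobayashi2003, Thm. 1.2, Thm. 4.1 and Conjecture (p. 2)]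
[cite: Pollack2003, Prop. 6.9, 6.10 and 6.18] [cite: DokchitserDokchitserAnnals2010, Thm. 1.4] -/
theorem kobayashiMainConjecture_neg_one_of_mazurTate_of_p_parity'
    (h12 : Kobayashi2003.thm12_signedSelmerDual_finite_torsion)
    (h41 : Kobayashi2003.thm41_signedCharIdeal_divisibility)
    (h5 : realPeriodRat_eq_unit_mul_plusPeriod) (h3 : realPeriodRat_eq_unit_mul_plusPeriod_three)
    (hL20 : Wuthrich2014.lemma20_surjective_threeAdic_of_semistable) (hpar : p_parity W p)
    (hp : p ≠ 2) (hgood : W.HasGoodReductionAtPrime p) (hap : W.frobeniusTrace p = 0) (hs : Surj W p)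
    [NeZero (W.conductorNorm ℤ)] {f₀ : CuspForm (Gamma0 (W.conductorNorm ℤ)) 2} (hf₀ : IsNewformOf W f₀)
    {n : ℕ} (hn : Odd n) {Θ : IwasawaAlgebra p}
    (hΘ : iwasawaToPowerSeries p Θ =
      ((mazurTateElement f₀ p n).map (algebraMap ℚ ℚ_[p]) : PowerSeries ℚ_[p]))
    (hΘ0 : Θ ≠ 0) (hμ : mu Θ = 0) (hlam : lam Θ = (cyclotomicOmegaPlus p n).natDegree + 1)
    (hlt : lam Θ < p ^ n) : KobayashiMainConjecture W p (-1) :=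
  kobayashiMainConjecture_neg_one_of_mazurTate_of_p_parity W p h12 h41 h5 h3 hL20 hpar
    cor414_sharpFlat_functionalEquation_apZero_holds hp hgood hap hs hf₀ hn hΘ hΘ0 hμ hlam hlt

/-- **Kobayashi's main conjecture for `(E, p, 1)` from ONE even-level Mazur–Tate element with
`λ(Θ) = deg ω_n^- + 1`**, surjective `ρ̄_{E,p}`, granted `h12`, `h41`, `h5`, `h3`, `hL20`, `hpar`.
[cite: Kobayashi2003, Thm. 1.2, Thm. 4.1 and Conjecture (p. 2)] [cite: Pollack2003, Prop. 6.9, 6.10 and 6.18]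
[cite: DokchitserDokchitserAnnals2010, Thm. 1.4] -/
theorem kobayashiMainConjecture_one_of_mazurTate_of_p_parity'
    (h12 : Kobayashi2003.thm12_signedSelmerDual_finite_torsion)
    (h41 : Kobayashi2003.thm41_signedCharIdeal_divisibility)
    (h5 : realPeriodRat_eq_unit_mul_plusPeriod) (h3 : realPeriodRat_eq_unit_mul_plusPeriod_three)
    (hL20 : Wuthrich2014.lemma20_surjective_threeAdic_of_semistable) (hpar : p_parity W p)
    (hp : p ≠ 2) (hgood : W.HasGoodReductionAtPrime p) (hap : W.frobeniusTrace p = 0) (hs : Surj W p)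
    [NeZero (W.conductorNorm ℤ)] {f₀ : CuspForm (Gamma0 (W.conductorNorm ℤ)) 2} (hf₀ : IsNewformOf W f₀)
    {n : ℕ} (hn : Even n) {Θ : IwasawaAlgebra p}
    (hΘ : iwasawaToPowerSeries p Θ =
      ((mazurTateElement f₀ p n).map (algebraMap ℚ ℚ_[p]) : PowerSeries ℚ_[p]))
    (hΘ0 : Θ ≠ 0) (hμ : mu Θ = 0) (hlam : lam Θ = (cyclotomicOmegaMinus p n).natDegree + 1)
    (hlt : lam Θ < p ^ n) : KobayashiMainConjecture W p 1 :=
  kobayashiMainConjecture_one_of_mazurTate_of_p_parity W p h12 h41 h5 h3 hL20 hpar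
    cor414_sharpFlat_functionalEquation_apZero_holds hp hgood hap hs hf₀ hn hΘ hΘ0 hμ hlam hlt

end Summit.BirchSwinnertonDyer.BirchSwinnertonDyer.Theorems.LargeImageParityStratum


end
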